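import Summits.QuantumFields.BalabanUV.T4Continuum.Spine.NE1p.DressedRebornMuResponseRealSignWitness

/-!
# T⁴ programme, spine estimate NE1′ (node O3b/H2) — WITNESS «THE RESPONSE AT A REAL SOURCE IS A POSITIVE REAL»: the previous row's
# weak sign `0 ≤ Re(∂E(t+δ) − ∂E(t))` for the dressed one-cube output along W35's real source pencil is STRICT —
# `0 < Re(∂E(t+δ) − ∂E(t))` for `0 ≤ t`, `0 < δ`, `t + δ < 2` — because a non-decreasing logarithmic derivative with EQUAL values at `t`
# and `t + δ` would be CONSTANT on `[t, t+δ]`, making `log(1 + a)` AFFINE there (mean value inequality with `C = 0`) and forcing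
# `(1 + a(t+δ∕2))² = (1 + a(t))(1 + a(t+δ))` — against W107's STRICT midpoint log-convexity: convexity gives back what the limit lost

Cell `pub-balaban`, sub-cell `t4`, BINDER-OWNERS row NE1′; NE1′ formalisation crew, unit `b2b-balaban-t4-ne1p-formalise-leaf-06`
(LEAF PROVER 06, generation 14); crew row W117 ∕ DAG N29zzzzzzk of `t4/formal/NE1p/LEAVES.md` (BOOKED typer R-T158 `HOME/CLAIMS.log`
l.26083 on INTENT l.26038; cross-read X268); the
seat's FIFTH row, own-lineage follower of W111 «THE RESPONSE AT A REAL SOURCE IS A NONNEGATIVE REAL» `DressedRebornMuResponseRealSignWitness`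
(p245891), whose reader-mutant RM2 «`0 <` claimed — the limit gives only `≤`» is here turned into a THEOREM by a different argument).  ADDITIVE —
imports that module ONLY (→ W107 → W101 → W86 → W35 → W33 → W24, W51, S61); THEOREMS ONLY (0 def, 0 `def … : Prop`, 0 cite); BY NAME:
the previous row's `differentiableOn_act` ∕ `deriv_locE_mul_eq` ∕ `deriv_act_im_eq_zero` ∕ `logDeriv_act_mono` ∕ `response_real_nonneg`,
W107's `one_add_act_pos` ∕ `strict_logConvex`, W86's `actM_real_X₀`; Mathlib `HasDerivAt.real_of_complex`, `HasDerivAt.log`,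
`Convex.norm_image_sub_le_of_norm_deriv_le`, `Real.exp_log`; nothing restated.

WHY THIS FILE.  Passing the chained ratio inequality to the limit `h → 0` (previous row) can only give `≤`.  Strictness is recovered from
structure, not from limits: `φ = (log g)'` is non-decreasing on `[t, t+δ]` (previous row between ANY two points), so `φ(t) = φ(t+δ)` would pin
`φ` to a constant there; then `log g − φ(t)·s` has zero derivative on the interval, `log g` is affine, and its midpoint identity exponentiates
to an EQUALITY case of W107's strict inequality at `(t, δ∕2)` — impossible.
* §1 `hasDerivAt_g` (the real derivative of `g(s) = 1 + cM·(√π + ∫ incr (s·r))` at `|s| < 2` is `Re ∂a(s)`), `hasDerivAt_log_g`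
  (`(log g)'(s) = Re ∂a(s)∕g(s)` on `[0, 2)`).
* §2 **`logDeriv_act_strictMono`**: `Re ∂a(t)∕g(t) < Re ∂a(t+δ)∕g(t+δ)` for `0 < r`, `0 ≤ t`, `0 < δ`, `t + δ < 2`.
* §3 **`response_real_pos`**: `Im(∂E(t+δ) − ∂E(t)) = 0 ∧ 0 < Re(∂E(t+δ) − ∂E(t))`; decided `example` at `(0, 1)`.

HONEST FRAMING.  A decided toy on pv22's periodic carrier; [folklore] one-variable calculus only (derivative of `log`, the mean value
inequality on an interval, `exp ∘ log`); the STRICT SIGN is a property of W35's CHOSEN Gaussian-core activity along W33's live table — OUR toy —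
NOT a statement about Bałaban's (2.14) densities, their μ-derivatives or any printed constant; no wall discharged: (B1a) exercised at a TOY core
only, (w5)∕(w6) NOT discharged on Bałaban's densities; (B1b) ∕ (B3) ∕ (B5) untouched ((B3) = G-ne9p2-5 UNPRINTED, shared with NE9); 0 binders
instantiated on Bałaban's densities; no wall item; the NE1′ wall wording of record v1.8 (T4-DAG v48) — words, not kind — does NOT move;
R-t4r2-Q2 NOT met; ABSOLUTE RULE honoured (no numeral of print; nothing internally minted is cited).  NE1′ ⇐ the named binders — NOT proved, NOT
printed; spine PROVED 0∕9; count 9 unchanged.  Rung (B)+1 on ONE finite four-torus — NOT infinite volume, NOT a mass gap, NOT OS on ℝ⁴, NOT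
Clay.  HONEST DEPENDENCY: continuum YM on T⁴ ⇐ BetaPertH ∧ nine spine estimates (0/9 proved); BetaPertH ⇐ (D1) ∧ (D4) ∧ CAP+tail; G-an2-4
gates asym, D1 and NE2/3/4.
-/

noncomputable section

namespace Summit.QuantumFields.BalabanUV.T4Continuum.NE1p.DressedRebornMuResponseRealPositiveWitness

open Set Metric MeasureTheory Complex
open Literature.MathematicalPhysics.QuantumFieldTheory.Balaban1983to89
open Literature.MathematicalPhysics.QuantumFieldTheory.Balaban1983to89.B13Resummation (locE)
open Literature.MathematicalPhysics.QuantumFieldTheory.Balaban1983to89.TreeLengthTorus (TDom tsys)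
open Literature.MathematicalPhysics.QuantumFieldTheory.Balaban1983to89.TreeLengthTorusGeometry (tgeometry)
open Summit.QuantumFields.BalabanUV.T4Continuum.NE1p.DressedSmallFieldTorusWitness (X₀)
open Summit.QuantumFields.BalabanUV.T4Continuum.NE1p.DressedSmallFieldCoresWitness (E1 incr)
open Summit.QuantumFields.BalabanUV.T4Continuum.NE1p.DressedSmallFieldCoresMassWitness (cM actM)
open Summit.QuantumFields.BalabanUV.T4Continuum.NE1p.DressedRebornMuPartBipencilWitness (actM_real_X₀)
open Summit.QuantumFields.BalabanUV.T4Continuum.NE1p.DressedRebornMuPartLogConvexWitness (one_add_act_pos strict_logConvex)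
open Summit.QuantumFields.BalabanUV.T4Continuum.NE1p.DressedRebornMuResponseRealSignWitness (differentiableOn_act deriv_locE_mul_eq
  deriv_act_im_eq_zero logDeriv_act_mono response_real_nonneg)

variable (N : ℕ) [NeZero N] (r : ℝ) (hr : 0 ≤ r)

/-! ## §1 The real function `g = 1 + a` on the real pencil and its logarithmic derivative `φ = g'∕g` -/

open Classical in
/-- **THE REAL DERIVATIVE OF `g(s) = 1 + cM·(√π + ∫ incr (s·r))`** [decided toy]: at every real `|s| < 2`, `g` has the real derivative
`Re ∂a(s)` — the complex derivative of the holomorphic activity read along the real axis (`HasDerivAt.real_of_complex`, W86 `actM_real_X₀`).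
[folklore] -/
theorem hasDerivAt_g (k : ℕ) {s : ℝ} (hs : |s| < 2) :
    HasDerivAt (fun x : ℝ => 1 + cM r * (Real.sqrt Real.pi + ∫ v : E1, incr (x * r) v))
      (deriv (fun z : ℂ => actM N r hr k z (X₀ N)) (s : ℂ)).re s := by
  have hmem : (s : ℂ) ∈ ball (0 : ℂ) 2 := by
    rw [mem_ball_zero_iff, Complex.norm_real, Real.norm_eq_abs]; exact hs
  have hd := ((differentiableOn_act N r hr k).differentiableAt (isOpen_ball.mem_nhds hmem)).hasDerivAt
  have h1 := (hd.real_of_complex).const_add 1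
  refine h1.congr_of_eventuallyEq (Filter.Eventually.of_forall fun x => ?_)
  show 1 + cM r * (Real.sqrt Real.pi + ∫ v : E1, incr (x * r) v) = 1 + (actM N r hr k (x : ℂ) (X₀ N)).re
  rw [actM_real_X₀, Complex.ofReal_re]

open Classical in
/-- **`log g` HAS DERIVATIVE `φ = Re ∂a ∕ g` on `[0, 2)`** (`g > 0` there — W107 `one_add_act_pos`). [folklore] -/
theorem hasDerivAt_log_g (k : ℕ) {s : ℝ} (hs0 : 0 ≤ s) (hs : s < 2) :
    HasDerivAt (fun x : ℝ => Real.log (1 + cM r * (Real.sqrt Real.pi + ∫ v : E1, incr (x * r) v)))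
      ((deriv (fun z : ℂ => actM N r hr k z (X₀ N)) (s : ℂ)).re / (1 + cM r * (Real.sqrt Real.pi + ∫ v : E1, incr (s * r) v))) s := by
  have hg := hasDerivAt_g N r hr k (s := s) (by rw [abs_of_nonneg hs0]; exact hs)
  have hpos := one_add_act_pos r (t := s) (mul_nonneg hs0 hr)
  exact hg.log hpos.ne'

/-! ## §2 STRICT MONOTONICITY OF THE LOGARITHMIC DERIVATIVE: convexity gives back what the limit lost -/

open Classical in
/-- **THE LOGARITHMIC DERIVATIVE OF `1 + a` IS STRICTLY INCREASING ALONG THE NONNEGATIVE REAL SOURCE PENCIL** [decided toy]: for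
`0 < r`, `0 ≤ t`, `0 < δ`, `t + δ < 2`, `Re ∂a(t)∕g(t) < Re ∂a(t+δ)∕g(t+δ)`.  Were they EQUAL, the non-decreasing `φ` (row W⟨real sign⟩'s
`logDeriv_act_mono` between any two points) would be CONSTANT on `[t, t+δ]`, so `log g − φ(t)·s` has zero derivative there and `log g` is
AFFINE on `[t, t+δ]` (mean value inequality with `C = 0`): `g(t+δ∕2)² = g(t)·g(t+δ)` — against W107's STRICT midpoint log-convexity at
`(t, δ∕2)`. [folklore] -/
theorem logDeriv_act_strictMono (hr0 : 0 < r) (k : ℕ) {t δ : ℝ} (ht : 0 ≤ t) (hδ : 0 < δ) (h2 : t + δ < 2) :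
    (deriv (fun s : ℂ => actM N r hr k s (X₀ N)) (t : ℂ)).re / (1 + cM r * (Real.sqrt Real.pi + ∫ v : E1, incr (t * r) v)) <
      (deriv (fun s : ℂ => actM N r hr k s (X₀ N)) (((t + δ : ℝ)) : ℂ)).re /
        (1 + cM r * (Real.sqrt Real.pi + ∫ v : E1, incr ((t + δ) * r) v)) := by
  -- notation: `φ s = Re ∂a(s) ∕ g(s)` (a local abbreviation, no `def`)
  set φ : ℝ → ℝ := fun s => (deriv (fun z : ℂ => actM N r hr k z (X₀ N)) (s : ℂ)).re /
    (1 + cM r * (Real.sqrt Real.pi + ∫ v : E1, incr (s * r) v)) with hφ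
  refine lt_of_le_of_ne (logDeriv_act_mono N r hr hr0 k ht hδ h2) fun heq => ?_
  change φ t = φ (t + δ) at heq
  -- `φ` is non-decreasing between any two points of `[t, t+δ]`, hence CONSTANT there
  have hmono : ∀ s s' : ℝ, t ≤ s → s < s' → s' ≤ t + δ → φ s ≤ φ s' := by
    intro s s' hs hss' hs'
    have h := logDeriv_act_mono N r hr hr0 k (t := s) (δ := s' - s) (ht.trans hs) (by linarith) (by linarith)
    have e : s + (s' - s) = s' := by ring
    rw [e] at h
    exact h
  have hconst : ∀ s : ℝ, t ≤ s → s ≤ t + δ → φ s = φ t := by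
    intro s hs hs'
    rcases eq_or_lt_of_le hs with h0 | h0
    · rw [h0]
    rcases eq_or_lt_of_le hs' with h1 | h1
    · rw [h1]; exact heq.symm
    exact le_antisymm (by rw [heq]; exact hmono s (t + δ) hs h1 le_rfl) (hmono t s le_rfl h0 hs')
  -- `log g − φ(t)·s` has zero derivative on `[t, t+δ]`
  have hderiv : ∀ s ∈ Icc t (t + δ), HasDerivAt
      ((fun x : ℝ => Real.log (1 + cM r * (Real.sqrt Real.pi + ∫ v : E1, incr (x * r) v))) - fun y : ℝ => φ t * y) 0 s := by
    intro s hs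
    have hLd := hasDerivAt_log_g N r hr k (s := s) (ht.trans hs.1) (by linarith [hs.2])
    have h := hLd.sub ((hasDerivAt_id s).const_mul (φ t))
    have hz : (deriv (fun z : ℂ => actM N r hr k z (X₀ N)) (s : ℂ)).re /
          (1 + cM r * (Real.sqrt Real.pi + ∫ v : E1, incr (s * r) v)) - φ t * 1 = 0 := by
      rw [mul_one, sub_eq_zero]; exact hconst s hs.1 hs.2
    rw [hz] at h
    exact h
  -- so `log g` is AFFINE on `[t, t+δ]` (mean value inequality with `C = 0`)
  have haff : ∀ s ∈ Icc t (t + δ),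
      Real.log (1 + cM r * (Real.sqrt Real.pi + ∫ v : E1, incr (s * r) v)) - φ t * s =
        Real.log (1 + cM r * (Real.sqrt Real.pi + ∫ v : E1, incr (t * r) v)) - φ t * t := by
    intro s hs
    have h := (convex_Icc t (t + δ)).norm_image_sub_le_of_norm_deriv_le
      (f := (fun x : ℝ => Real.log (1 + cM r * (Real.sqrt Real.pi + ∫ v : E1, incr (x * r) v))) - fun y : ℝ => φ t * y) (C := 0)
      (fun x hx => (hderiv x hx).differentiableAt) (fun x hx => by rw [(hderiv x hx).deriv, norm_zero])
      (left_mem_Icc.2 (by linarith)) hs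
    rw [zero_mul] at h
    have h0 := sub_eq_zero.1 (norm_le_zero_iff.1 h)
    simpa only [Pi.sub_apply] using h0
  -- midpoint: `2·log g(t + δ∕2) = log g(t) + log g(t + δ)`
  have hm : t + δ / 2 ∈ Icc t (t + δ) := ⟨by linarith, by linarith⟩
  have he : t + δ ∈ Icc t (t + δ) := ⟨by linarith, le_rfl⟩
  have hmid : Real.log (1 + cM r * (Real.sqrt Real.pi + ∫ v : E1, incr ((t + δ / 2) * r) v)) +
        Real.log (1 + cM r * (Real.sqrt Real.pi + ∫ v : E1, incr ((t + δ / 2) * r) v)) =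
      Real.log (1 + cM r * (Real.sqrt Real.pi + ∫ v : E1, incr (t * r) v)) +
        Real.log (1 + cM r * (Real.sqrt Real.pi + ∫ v : E1, incr ((t + δ) * r) v)) := by
    have h1 := haff _ hm
    have h2 := haff _ he
    linarith
  -- exponentiate: `g(t+δ∕2)² = g(t)·g(t+δ)` — against STRICT midpoint log-convexity at `(t, δ∕2)`
  have hgm : 0 < (1 + cM r * (Real.sqrt Real.pi + ∫ v : E1, incr ((t + δ / 2) * r) v)) := one_add_act_pos r (mul_nonneg (by linarith) hr)
  have hgt : 0 < (1 + cM r * (Real.sqrt Real.pi + ∫ v : E1, incr (t * r) v)) := one_add_act_pos r (mul_nonneg ht hr)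
  have hgd : 0 < (1 + cM r * (Real.sqrt Real.pi + ∫ v : E1, incr ((t + δ) * r) v)) := one_add_act_pos r (mul_nonneg (by linarith) hr)
  have hsq : (1 + cM r * (Real.sqrt Real.pi + ∫ v : E1, incr ((t + δ / 2) * r) v)) ^ 2 =
      (1 + cM r * (Real.sqrt Real.pi + ∫ v : E1, incr (t * r) v)) * (1 + cM r * (Real.sqrt Real.pi + ∫ v : E1, incr ((t + δ) * r) v)) := by
    have h := congrArg Real.exp hmid
    rw [Real.exp_add, Real.exp_add, Real.exp_log hgm, Real.exp_log hgt, Real.exp_log hgd] at h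
    rw [sq]; exact h
  have hlt := strict_logConvex r hr hr0 (t := t) (δ := δ / 2) ht (by linarith)
  rw [show t + 2 * (δ / 2) = t + δ by ring] at hlt
  exact absurd hsq (ne_of_lt hlt)

/-! ## §3 THE RESPONSE AT A REAL SOURCE IS A POSITIVE REAL -/

open Classical in
/-- **THE RESPONSE OF THE `δ`-RE-BORN PART AT A REAL SOURCE IS A POSITIVE REAL NUMBER** [decided toy]: for `0 < r`, `0 ≤ t`, `0 < δ`,
`t + δ < 2`, `Im(∂E(t+δ) − ∂E(t)) = 0` and `0 < Re(∂E(t+δ) − ∂E(t))` — row W⟨real sign⟩'s weak sign made STRICT by §2. [folklore] -/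
theorem response_real_pos (hr0 : 0 < r) (k : ℕ) {t δ : ℝ} (ht : 0 ≤ t) (hδ : 0 < δ) (h2 : t + δ < 2) :
    (deriv (fun s : ℂ => locE (tgeometry 4 N).ι (tgeometry 4 N).cubes (actM N r hr k s) ((tgeometry 4 N).cubes (X₀ N))) (((t + δ : ℝ)) : ℂ) -
        deriv (fun s : ℂ => locE (tgeometry 4 N).ι (tgeometry 4 N).cubes (actM N r hr k s) ((tgeometry 4 N).cubes (X₀ N))) (t : ℂ)).im = 0 ∧
    0 < (deriv (fun s : ℂ => locE (tgeometry 4 N).ι (tgeometry 4 N).cubes (actM N r hr k s) ((tgeometry 4 N).cubes (X₀ N))) (((t + δ : ℝ)) : ℂ) -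
        deriv (fun s : ℂ => locE (tgeometry 4 N).ι (tgeometry 4 N).cubes (actM N r hr k s) ((tgeometry 4 N).cubes (X₀ N))) (t : ℂ)).re := by
  refine ⟨(response_real_nonneg N r hr hr0 k ht hδ h2).1, ?_⟩
  -- the two derivatives as real quotients (as in row W⟨real sign⟩)
  have key : ∀ s : ℝ, 0 ≤ s → s < 2 →
      deriv (fun s : ℂ => locE (tgeometry 4 N).ι (tgeometry 4 N).cubes (actM N r hr k s) ((tgeometry 4 N).cubes (X₀ N))) (s : ℂ) =
        ((((deriv (fun s : ℂ => actM N r hr k s (X₀ N)) (s : ℂ)).re /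
          (1 + cM r * (Real.sqrt Real.pi + ∫ v : E1, incr (s * r) v)) : ℝ)) : ℂ) := by
    intro s hs0 hs2
    have hs : ‖(s : ℂ)‖ < 2 := by rw [Complex.norm_real, Real.norm_eq_abs, abs_of_nonneg hs0]; exact hs2
    have h := deriv_locE_mul_eq N r hr k hs
    rw [actM_real_X₀] at h
    set D := deriv (fun s : ℂ => locE (tgeometry 4 N).ι (tgeometry 4 N).cubes (actM N r hr k s) ((tgeometry 4 N).cubes (X₀ N))) (s : ℂ)
    set A := deriv (fun s : ℂ => actM N r hr k s (X₀ N)) (s : ℂ) with hA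
    set ρ : ℝ := A.re with hρ
    set gs : ℝ := 1 + cM r * (Real.sqrt Real.pi + ∫ v : E1, incr (s * r) v) with hgs
    have hgs0 : gs ≠ 0 := (one_add_act_pos r (mul_nonneg hs0 hr)).ne'
    have hne : ((gs : ℝ) : ℂ) ≠ 0 := Complex.ofReal_ne_zero.2 hgs0
    have ha : A = (ρ : ℂ) := by
      refine Complex.ext (by simp [hρ]) ?_
      rw [Complex.ofReal_im, hA]; exact deriv_act_im_eq_zero N r hr k hs0 hs2
    have h2' : D * ((gs : ℝ) : ℂ) = A := by rw [hgs]; exact_mod_cast h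
    have h3 : D = A / ((gs : ℝ) : ℂ) := by rw [← h2', mul_div_assoc, div_self hne, mul_one]
    rw [h3, ha, ← Complex.ofReal_div]
  rw [key (t + δ) (by linarith) h2, key t ht (by linarith), ← Complex.ofReal_sub, Complex.ofReal_re]
  exact sub_pos.2 (logDeriv_act_strictMono N r hr hr0 k ht hδ h2)

open Classical in
/-- **DECIDED**: at `(t, δ) = (0, 1)` the response `∂E(1) − ∂E(0)` is a POSITIVE real. [located] -/
example (hr0 : 0 < r) (k : ℕ) :
    0 < (deriv (fun s : ℂ => locE (tgeometry 4 N).ι (tgeometry 4 N).cubes (actM N r hr k s) ((tgeometry 4 N).cubes (X₀ N))) (((0 + 1 : ℝ)) : ℂ) -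
        deriv (fun s : ℂ => locE (tgeometry 4 N).ι (tgeometry 4 N).cubes (actM N r hr k s) ((tgeometry 4 N).cubes (X₀ N))) ((0 : ℝ) : ℂ)).re :=
  (response_real_pos N r hr hr0 k le_rfl one_pos (by norm_num)).2

end Summit.QuantumFields.BalabanUV.T4Continuum.NE1p.DressedRebornMuResponseRealPositiveWitness

end
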